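import Summits.CriticalPhenomena.PercolationContinuityZ3.Theorems.Transplant.BccSlabHubRoute
import HarnessLib

/-!
# The bcc (001)-slabs, exit-form routing certificate for THICKNESS `k = 2`, I: THE EVEN-HUB TEMPLATE — a swap pair of routings from a planar claw whose
# hub column carries TWO vertices (every `k ≥ 2`)

builds on p205010 (kernel theorem, internal audit signed; external expert review pending) — NOT used in this file.
Lane `prim-bschramm`, seat `prim-bschramm-p2` (gen 47; class C1b = films / other 3D lattices at their own critical point, METHOD = input
substitution; memo `HOME/bschramm/P2-LATTICES.md` §157); helper file (`--supports stmt-CriticalPhenomena-4575 --as helper`).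

WHY.  «BccSlabHubRoute».`BccSlab.swapPair_of_clawProps` turns a planar claw (hub column `Q`, three column-disjoint legs) into a SWAP PAIR of routings
with hub vertices `(Q, h₀)`, `(Q, h₀ + 2)` (`h₀ ∈ {0, 1}` the parity of `Q₀ + Q₁`) — it needs `h₀ + 2 ≤ k`, whence its hypothesis `3 ≤ k`.  In the
thinnest open case `k = 2` (memo §156 (5): `k = 1` is injective, `k ≥ 3` is «BccSlabStackedRoute».`theta_criticalProb_eq_zero`) a column `Q` carries the
two vertices `(Q, 0)`, `(Q, 2)` exactly when `Q₀ + Q₁` is EVEN, and then the same construction works with `h₀ = 0`: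
* **`BccSlab.swapPair_of_clawProps_even`** (`k ≥ 2`, hub column `pt z q` with `Even (z₀ + z₁ + q₁ + q₂)`): the swap pair of `VRouteData` for the cleared
  sets of «BccSlabClearedSetX» from a claw («BccClawXSound».`ClawProps`) with an EVEN hub.
The parity-aware planar claw table that feeds it is «BccClawX2Table*»; the assembly for `k = 2` is «BccSlabTwoRoute».
[cite: DuminilCopinSidoraviciusTassion2016, §2.3 (proof of Fact 2: the three disjoint paths γ_u, γ_v, γ_w in B̄_R(z))] [cite: ConwaySloane1999, Ch. 4 §7.1]
-/

noncomputable section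

namespace Summit.CriticalPhenomena.PercolationContinuityZ3.Theorems.Transplant

namespace BccSlab

open Literature.Probability.Percolation Literature.Probability.LatticeModels SimpleGraph
open BccClawX
open scoped Classical

variable {k : ℕ}

/-- **FROM A PLANAR CLAW WITH AN EVEN HUB TO A SWAP PAIR** (`k ≥ 2`): hub vertices `y = (Q, 0)`, `b = (Q, 2)` over the hub column `Q = pt z q` with
`Q₀ + Q₁` even, ports `c, m, n` at height `1` over the first columns of the legs, the three legs lifted by «BccSlabHubRoute».`exists_lift'` to
self-avoiding slab paths ending at `E₁, E₂, w'`; column-disjointness of the legs gives vertex-disjointness, the regions give the cleared-set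
conditions (verbatim the construction of «BccSlabHubRoute».`swapPair_of_clawProps` with `h₀ = 0`).
[cite: DuminilCopinSidoraviciusTassion2016, §2.3 (proof of Fact 2: the three disjoint paths in B̄_R(z))] -/
theorem swapPair_of_clawProps_even (hk : 2 ≤ k) {z : Site 2} {tR tD sR sD : ℕ} {E₁ E₂ w' : bslab k} (hne : E₁ ≠ E₂) {q : Pt} {l1 l2 l3 : List Pt}
    (hpar : Even (z 0 + z 1 + q.1 + q.2))
    (hP : ClawProps (min tR 3) (min tD 4) (min sR 3) (min sD 4) (rel z (sh E₁)) (rel z (sh E₂)) (rel z (sh w')) q l1 l2 l3) :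
    ∃ r₁ r₂ : VRouteData (slabGraph k) (clearedSet k z tD sD ∩ (sqShadow k).lift (sqBlkR 3 z tR sR)) (clearedSet k z tD sD) E₁ E₂ w',
      r₁.y = r₂.b ∧ r₁.b = r₂.y := by
  have hk1 : 1 ≤ k := le_trans (by norm_num) hk
  have hk' : (2 : ℤ) ≤ k := by exact_mod_cast hk
  -- the hub column and its two vertices (heights `0` and `2`)
  obtain ⟨Q, hQ⟩ : ∃ Q : Site 2, Q = pt z q := ⟨_, rfl⟩
  have hQe : Even (Q 0 + Q 1 - 0) := by
    rw [sub_zero, hQ, pt_apply_zero, pt_apply_one]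
    have : z 0 + q.1 + (z 1 + q.2) = z 0 + z 1 + q.1 + q.2 := by ring
    rw [this]; exact hpar
  have hAy : Adm k Q 0 := ⟨le_rfl, by positivity, hQe⟩
  have hAb : Adm k Q (0 + 2) := ⟨by norm_num, by omega, by obtain ⟨m, hm⟩ := hQe; exact ⟨m - 1, by omega⟩⟩
  set y : bslab k := vtx k Q 0 with hy
  set b : bslab k := vtx k Q (0 + 2) with hb
  have hysh : sh y = Q := sh_vtx hAy
  have hbsh : sh b = Q := sh_vtx hAb
  have hyb : y ≠ b := by
    intro e; have := (vtx_eq_vtx_iff hAy hAb).1 e; omega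
  -- the legs as columns of `Site 2`
  obtain ⟨hne1, hc1, hnd1, hlen1, hends1, hR1, hq1, -, hadj1⟩ := leg_site hP.leg1 z
  obtain ⟨hne2, hc2, hnd2, hlen2, hends2, hR2, hq2, -, hadj2⟩ := leg_site hP.leg2 z
  obtain ⟨hne3, hc3, hnd3, hlen3, hends3, hR3, hq3, -, hadj3⟩ := leg_site hP.leg3 z
  rw [← hQ] at hq1 hq2 hq3 hadj1 hadj2 hadj3
  obtain ⟨hhead1, hlast1⟩ := hends1 hne1
  obtain ⟨hhead2, hlast2⟩ := hends2 hne2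
  obtain ⟨hhead3, hlast3⟩ := hends3 hne3
  rw [pt_rel] at hlast1 hlast2 hlast3
  -- the ports (height `1` over the first columns of the legs)
  set P₁ : Site 2 := pt z (l1.head hP.leg1.ne_nil) with hP₁
  set P₂ : Site 2 := pt z (l2.head hP.leg2.ne_nil) with hP₂
  set P₃ : Site 2 := pt z (l3.head hP.leg3.ne_nil) with hP₃
  have hA1 : Adm k P₁ (0 + 1) := adm_port hAy hadj1 (by omega)
  have hA2 : Adm k P₂ (0 + 1) := adm_port hAy hadj2 (by omega)
  have hA3 : Adm k P₃ (0 + 1) := adm_port hAy hadj3 (by omega)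
  set c : bslab k := vtx k P₁ (0 + 1) with hc
  set m : bslab k := vtx k P₂ (0 + 1) with hm
  set n : bslab k := vtx k P₃ (0 + 1) with hn
  have hcy : (slabGraph k).Adj c y := adj_vtx hA1 hAy hadj1.symm (Or.inr (by ring))
  have hcb : (slabGraph k).Adj c b := adj_vtx hA1 hAb hadj1.symm (Or.inl (by ring))
  have hym : (slabGraph k).Adj y m := adj_vtx hAy hA2 hadj2 (Or.inl rfl)
  have hbm : (slabGraph k).Adj b m := adj_vtx hAb hA2 hadj2 (Or.inr (by ring))
  have hyn : (slabGraph k).Adj y n := adj_vtx hAy hA3 hadj3 (Or.inl rfl)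
  have hbn : (slabGraph k).Adj b n := adj_vtx hAb hA3 hadj3 (Or.inr (by ring))
  -- the lifts
  obtain ⟨LA, hGA, hcolA, honceA⟩ := exists_lift' hk1 hne1 hc1 hnd1 hlen1 c E₁ (by rw [hhead1]; exact sh_vtx hA1) (by rw [hlast1])
  obtain ⟨LB, hGB, hcolB, honceB⟩ := exists_lift' hk1 hne2 hc2 hnd2 hlen2 m E₂ (by rw [hhead2]; exact sh_vtx hA2) (by rw [hlast2])
  obtain ⟨LC, hGC, hcolC, -⟩ := exists_lift' hk1 hne3 hc3 hnd3 hlen3 n w' (by rw [hhead3]; exact sh_vtx hA3) (by rw [hlast3])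
  -- cleared-set conditions
  have hWR : ∀ x : bslab k, inRPp (min tR 3) (min tD 4) (min sR 3) (min sD 4) (rel z (sh x)) = true →
      x ∈ clearedSet k z tD sD ∩ (sqShadow k).lift (sqBlkR 3 z tR sR) := by
    intro x hx
    obtain ⟨hD, hRb⟩ := inRPp_rel_iff.1 hx
    exact ⟨hD, by rw [SqShadow.mem_lift, sqShadow_sh]; exact hRb⟩
  have hAW : ∀ x ∈ LA, x ∈ clearedSet k z tD sD ∩ (sqShadow k).lift (sqBlkR 3 z tR sR) := fun x hx => hWR x (hR1 _ (hcolA x hx))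
  have hBW : ∀ x ∈ LB, x ∈ clearedSet k z tD sD ∩ (sqShadow k).lift (sqBlkR 3 z tR sR) := fun x hx => hWR x (hR2 _ (hcolB x hx))
  have hCW : ∀ x ∈ LC, x ∈ clearedSet k z tD sD := fun x hx => inDp_rel_iff.1 (hR3 _ (hcolC x hx))
  have hqW : inRPp (min tR 3) (min tD 4) (min sR 3) (min sD 4) (rel z Q) = true := by rw [hQ, rel_pt]; exact hP.hq
  have hyW := hWR y (by rw [hysh]; exact hqW)
  have hbW := hWR b (by rw [hbsh]; exact hqW)
  -- disjointness
  have hyA : y ∉ LA := fun h => hq1 (hysh ▸ hcolA y h)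
  have hyB : y ∉ LB := fun h => hq2 (hysh ▸ hcolB y h)
  have hyC : y ∉ LC := fun h => hq3 (hysh ▸ hcolC y h)
  have hbA : b ∉ LA := fun h => hq1 (hbsh ▸ hcolA b h)
  have hbB : b ∉ LB := fun h => hq2 (hbsh ▸ hcolB b h)
  have hbC : b ∉ LC := fun h => hq3 (hbsh ▸ hcolC b h)
  have hAB : ∀ x ∈ LA, x ∉ LB := by
    intro x hxA hxB
    have h1 := hcolA x hxA
    have h2 := hcolB x hxB
    obtain ⟨p, hp, hpx⟩ := List.mem_map.1 h1
    obtain ⟨p', hp', hp'x⟩ := List.mem_map.1 h2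
    have hpp : p = p' := pt_injective z (hpx.trans hp'x.symm)
    obtain ⟨heq, hpa⟩ := hP.d12 p hp (hpp ▸ hp')
    -- both legs end in the shared column, visited only at `E₁`, `E₂`
    have hl1 : 3 ≤ (l1.map (pt z)).length := by simpa using hP.len1 heq
    have hl2 : 3 ≤ (l2.map (pt z)).length := by simpa using hP.len2 heq
    have hx1 : x = E₁ := honceA hl1 x hxA (by rw [hlast1, ← hpx, hpa, pt_rel])
    have hx2 : x = E₂ := honceB hl2 x hxB (by rw [hlast2, ← hp'x, ← hpp, hpa, heq, pt_rel])
    exact hne (hx1.symm.trans hx2)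
  have hAC : ∀ x ∈ LA, x ∉ LC := by
    intro x hxA hxC
    obtain ⟨p, hp, hpx⟩ := List.mem_map.1 (hcolC x hxC)
    exact hP.d31 p hp (by have := hcolA x hxA; rw [← hpx] at this; obtain ⟨p', hp', e⟩ := List.mem_map.1 this; rwa [← pt_injective z e])
  have hBC : ∀ x ∈ LB, x ∉ LC := by
    intro x hxB hxC
    obtain ⟨p, hp, hpx⟩ := List.mem_map.1 (hcolC x hxC)
    exact hP.d32 p hp (by have := hcolB x hxB; rw [← hpx] at this; obtain ⟨p', hp', e⟩ := List.mem_map.1 this; rwa [← pt_injective z e])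
  exact VRouteData.swapPair_of_hub hGA hGB hGC hne hAW hBW hCW hyW hbW (fun x hx => hx.1) hcy hcb hym hbm hyn hbn hyb hAB hAC hBC
    hyA hyB hyC hbA hbB hbC

end BccSlab

end Summit.CriticalPhenomena.PercolationContinuityZ3.Theorems.Transplant

end
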